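import Mathlib
import Summits.RiemannHypothesis.RiemannHypothesis.Theorems.SignConeConeMagnificationDesignStepOne

/-!
# Crux `SignCone.ConeMagnification` (stmt-RiemannHypothesis-16303), line `Sketch` r8, stub `stub_designOfTypes`:
# AX-B — the composite mass bound from the `±τ` first-order designs

Seat-0 programme for the open core `stub_designOfTypes` (design algebra §4).  For a finite set `S` of primes the two
first-order product designs with ratios `1 ± τ_q`, `τ_q = (√q − 1)/2`, have profiles `Z_±(n) = Π_{q∈S, q∣n}(1 ± τ_q)`;
adding the two type inequalities kills the odd classes, the classes of size `≤ 1` contribute `Z₊ + Z₋ − 2 = 0`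
(so the negative part of `c − Λ`, which lives on prime powers, disappears), and on classes of size `≥ 2` (where
`Λ = 0`) `Z₊ + Z₋ − 2 ≥ (Σ τ)² − Σ τ² = 2 e₂`.  Hence `Σ'_n (c(n)/n) e₂^S(n) ≤ ½ − C₁` uniformly in `S`
(`compMass_level_le`) and AX-B follows (`summable_compMassTerm`).
-/

noncomputable section

-- `Summit.RiemannHypothesis.RiemannHypothesis.…` repeats a namespace component by design (D-0017 layout).
set_option linter.dupNamespace false

open Finset Filter
open scoped BigOperators ComplexConjugate Topology

namespace Summit.RiemannHypothesis.RiemannHypothesis.Theorems.SignConeConeMagnification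

namespace Design

/-! ### The even part of `Π(1+τ) + Π(1−τ)` -/

/-- Joint induction: for `τ ≥ 0` on `A`, `2 + ((Σ_A τ)² − Σ_A τ²) ≤ Π_A (1+τ) + Π_A (1−τ)`,
`2 Σ_A τ ≤ Π_A (1+τ) − Π_A (1−τ)` and `Σ_A τ² ≤ (Σ_A τ)²`. [folklore] -/
theorem evenPart_bounds (τ : ℕ → ℝ) (A : Finset ℕ) (hτ : ∀ q ∈ A, 0 ≤ τ q) :
    2 + ((∑ q ∈ A, τ q) ^ 2 - ∑ q ∈ A, τ q ^ 2) ≤ ∏ q ∈ A, (1 + τ q) + ∏ q ∈ A, (1 - τ q) ∧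
    2 * ∑ q ∈ A, τ q ≤ ∏ q ∈ A, (1 + τ q) - ∏ q ∈ A, (1 - τ q) ∧
    ∑ q ∈ A, τ q ^ 2 ≤ (∑ q ∈ A, τ q) ^ 2 := by
  classical
  induction A using Finset.induction_on with
  | empty => norm_num
  | insert p A hpA ih =>
    have hτA : ∀ q ∈ A, 0 ≤ τ q := fun q hq => hτ q (Finset.mem_insert_of_mem hq)
    have ht : 0 ≤ τ p := hτ p (Finset.mem_insert_self p A)
    obtain ⟨h1, h2, h3⟩ := ih hτA
    have hs : 0 ≤ ∑ q ∈ A, τ q := Finset.sum_nonneg hτA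
    rw [Finset.sum_insert hpA, Finset.sum_insert hpA, Finset.prod_insert hpA, Finset.prod_insert hpA]
    set s := ∑ q ∈ A, τ q
    set s₂ := ∑ q ∈ A, τ q ^ 2
    set P := ∏ q ∈ A, (1 + τ q)
    set M := ∏ q ∈ A, (1 - τ q)
    refine ⟨?_, ?_, ?_⟩
    · nlinarith [mul_nonneg ht (sub_nonneg.2 h2)]
    · nlinarith [mul_nonneg ht (sub_nonneg.2 h1), mul_nonneg ht (sub_nonneg.2 h3)]
    · nlinarith [mul_nonneg ht hs]

/-- Ordered pairs versus the closed form: `Σ_{q∈A} Σ_{q'∈A, q<q'} τ_q τ_q' = ((Σ_A τ)² − Σ_A τ²)/2`. [folklore] -/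
theorem sum_pairs_eq (τ : ℕ → ℝ) (A : Finset ℕ) :
    ∑ q ∈ A, ∑ q' ∈ A.filter (fun q' => q < q'), τ q * τ q' = ((∑ q ∈ A, τ q) ^ 2 - ∑ q ∈ A, τ q ^ 2) / 2 := by
  classical
  induction A using Finset.induction_on with
  | empty => simp
  | insert p A hpA ih =>
    rw [Finset.sum_insert hpA, Finset.sum_insert hpA, Finset.sum_insert hpA]
    -- the `q = p` row
    have hrow : ∑ q' ∈ (insert p A).filter (fun q' => p < q'), τ p * τ q' =
        ∑ q' ∈ A.filter (fun q' => p < q'), τ p * τ q' := by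
      rw [Finset.filter_insert, if_neg (lt_irrefl p)]
    -- the rows `q ∈ A`
    have hrows : ∑ q ∈ A, ∑ q' ∈ (insert p A).filter (fun q' => q < q'), τ q * τ q' =
        ∑ q ∈ A, ∑ q' ∈ A.filter (fun q' => q < q'), τ q * τ q' + ∑ q ∈ A.filter (fun q => q < p), τ q * τ p := by
      rw [Finset.sum_filter, ← Finset.sum_add_distrib]
      refine Finset.sum_congr rfl fun q hq => ?_
      rw [Finset.filter_insert]
      by_cases hqp : q < p
      · rw [if_pos hqp, Finset.sum_insert (fun h => hpA (Finset.mem_filter.1 h).1), if_pos hqp]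
        ring
      · rw [if_neg hqp, if_neg hqp, add_zero]
    rw [hrow, hrows, ih]
    -- `Σ_{p<q'} τ_q' + Σ_{q<p} τ_q = Σ_A τ` since `p ∉ A`
    have hsplit : ∑ q' ∈ A.filter (fun q' => p < q'), τ p * τ q' + ∑ q ∈ A.filter (fun q => q < p), τ q * τ p =
        τ p * ∑ q ∈ A, τ q := by
      have h1 : ∑ q ∈ A.filter (fun q => q < p), τ q * τ p = ∑ q ∈ A.filter (fun q => q < p), τ p * τ q :=
        Finset.sum_congr rfl fun q _ => mul_comm _ _
      rw [h1, ← Finset.mul_sum, ← Finset.mul_sum, ← mul_add]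
      congr 1
      rw [← Finset.sum_filter_add_sum_filter_not A (fun q => p < q)]
      congr 1
      refine Finset.sum_congr ?_ fun _ _ => rfl
      ext q
      simp only [Finset.mem_filter, not_lt]
      constructor
      · rintro ⟨hq, hlt⟩
        exact ⟨hq, le_of_lt hlt⟩
      · rintro ⟨hq, hle⟩
        refine ⟨hq, lt_of_le_of_ne hle (fun h => hpA ?_)⟩
        rw [← h]; exact hq
    linarith [hsplit]

/-- The ratios `1 ± (√p−1)/2` are admissible first-order ratios. [folklore] -/
theorem pm_tau_admissible (p : ℕ) (hp : p.Prime) (ε : ℝ) (hε : ε = 1 ∨ ε = -1) :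
    1 - (Real.sqrt p + 1) / 2 ≤ 1 + ε * ((Real.sqrt p - 1) / 2) ∧
      1 + ε * ((Real.sqrt p - 1) / 2) ≤ 1 + (Real.sqrt p - 1) / 2 := by
  have hs1 : 1 ≤ Real.sqrt p := by
    rw [show (1 : ℝ) = Real.sqrt 1 from Real.sqrt_one.symm]
    exact Real.sqrt_le_sqrt (by exact_mod_cast hp.one_lt.le)
  rcases hε with h | h <;> subst h <;> constructor <;> nlinarith

/-! ### The composite mass at a finite level -/

/-- **Composite mass at level `S`** (seat-0, design algebra §4): under Loc and TI, for every finite set `S` of primes,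
`Σ'_{n touching S} (c(n)/n) · Σ_{q<q' ∈ S, q,q' ∣ n} τ_q τ_q' ≤ ½ − C₁`, `τ_q = (√q−1)/2`. [folklore] -/
theorem compMass_level_le (c : ℕ → ℝ) (hc0 : ∀ n, 0 ≤ c n)
    (hLoc : ∀ p : ℕ, p.Prime → Summable (fun n : ℕ => if p ∣ n then c n / n else 0))
    (hTI : ∀ α : ℕ → ℂ, ∀ L : ℕ, (∀ m, L < m → α m = 0) →
      ∃ T : ℝ, Tendsto (fun x : ℝ => ∑ n ∈ Finset.Icc 1 ⌊x⌋₊,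
          (c n - ArithmeticFunction.vonMangoldt n) / n *
            (∑ ℓ ∈ Finset.Icc 1 L, ∑ ℓ' ∈ Finset.Icc 1 L, α ℓ * (starRingEnd ℂ) (α ℓ') *
            (((Nat.gcd (n * ℓ') ℓ : ℕ) : ℝ) : ℂ) / (Real.sqrt ((ℓ : ℝ) * ℓ') : ℂ)).re) atTop (𝓝 T) ∧
        T ≤ 1 / 2 * (∑ ℓ ∈ Finset.Icc 1 L, ∑ ℓ' ∈ Finset.Icc 1 L, α ℓ * (starRingEnd ℂ) (α ℓ') *
            (((Nat.gcd (1 * ℓ') ℓ : ℕ) : ℝ) : ℂ) / (Real.sqrt ((ℓ : ℝ) * ℓ') : ℂ)).re)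
    (C₁ : ℝ) (hC₁ : Tendsto (fun x : ℝ => ∑ n ∈ Finset.Icc 1 ⌊x⌋₊,
        (c n - ArithmeticFunction.vonMangoldt n) / n) atTop (𝓝 C₁))
    (S : Finset ℕ) (hS : ∀ q ∈ S, q.Prime) :
    Summable (fun n : ℕ => if (∃ q ∈ S, q ∣ n) then c n / n *
        (∑ q ∈ S.filter (· ∣ n), ∑ q' ∈ (S.filter (· ∣ n)).filter (fun q' => q < q'),
          ((Real.sqrt q - 1) / 2) * ((Real.sqrt q' - 1) / 2)) else 0) ∧
    ∑' n : ℕ, (if (∃ q ∈ S, q ∣ n) then c n / n *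
        (∑ q ∈ S.filter (· ∣ n), ∑ q' ∈ (S.filter (· ∣ n)).filter (fun q' => q < q'),
          ((Real.sqrt q - 1) / 2) * ((Real.sqrt q' - 1) / 2)) else 0) ≤ 1 / 2 - C₁ := by
  classical
  set τ : ℕ → ℝ := fun q => (Real.sqrt q - 1) / 2 with hτdef
  have hτ0 : ∀ q ∈ S, 0 ≤ τ q := by
    intro q hq
    have hs1 : 1 ≤ Real.sqrt q := by
      rw [show (1 : ℝ) = Real.sqrt 1 from Real.sqrt_one.symm]
      exact Real.sqrt_le_sqrt (by exact_mod_cast (hS q hq).one_lt.le)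
    simp only [hτdef]; linarith
  -- the two designs and their TI limits
  have hdes : ∀ ε : ℝ, (ε = 1 ∨ ε = -1) → ∃ T : ℝ, Tendsto (fun x : ℝ => ∑ n ∈ Finset.Icc 1 ⌊x⌋₊,
      (c n - ArithmeticFunction.vonMangoldt n) / n * ∏ q ∈ S.filter (· ∣ n), (1 + ε * τ q)) atTop (𝓝 T) ∧
      T ≤ 1 / 2 := by
    intro ε hε
    obtain ⟨α, L, K, hK, hsupp, hprof⟩ := gcdForm_firstOrderDesign S hS (fun q => 1 + ε * τ q)
      (fun q hq => pm_tau_admissible q (hS q hq) ε hε)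
    set Z : ℕ → ℂ := fun n => ((∏ q ∈ S.filter (· ∣ n), (1 + ε * τ q) : ℝ) : ℂ) with hZdef
    have hZ : ∀ n : ℕ, n ≠ 0 → (∑ ℓ ∈ Finset.Icc 1 L, ∑ ℓ' ∈ Finset.Icc 1 L, α ℓ * (starRingEnd ℂ) (α ℓ') *
        (((Nat.gcd (n * ℓ') ℓ : ℕ) : ℝ) : ℂ) / (Real.sqrt ((ℓ : ℝ) * ℓ') : ℂ)) = (K : ℂ) * Z n := by
      intro n hn
      rw [hprof n hn, hZdef]
      push_cast
      ring
    obtain ⟨T, hT, hTle⟩ := tendsto_TI_profile c hTI α L K hK hsupp Z hZ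
    have hZre : ∀ n, (Z n).re = ∏ q ∈ S.filter (· ∣ n), (1 + ε * τ q) := fun n => by
      simp only [hZdef, Complex.ofReal_re]
    simp_rw [hZre] at hT hTle
    rw [filter_dvd_eq_empty (not_exists_prime_dvd_one hS), Finset.prod_empty, mul_one] at hTle
    exact ⟨T, hT, hTle⟩
  obtain ⟨Tp, hTp, hTple⟩ := hdes 1 (Or.inl rfl)
  obtain ⟨Tm, hTm, hTmle⟩ := hdes (-1) (Or.inr rfl)
  -- the sum of the two profiles
  set ψ : ℕ → ℝ := fun n => ∏ q ∈ S.filter (· ∣ n), (1 + τ q) + ∏ q ∈ S.filter (· ∣ n), (1 - τ q) with hψdef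
  have hT : Tendsto (fun x : ℝ => ∑ n ∈ Finset.Icc 1 ⌊x⌋₊,
      (c n - ArithmeticFunction.vonMangoldt n) / n * ψ n) atTop (𝓝 (Tp + Tm)) := by
    refine (hTp.add hTm).congr fun x => ?_
    rw [← Finset.sum_add_distrib]
    refine Finset.sum_congr rfl fun n _ => ?_
    simp only [hψdef, one_mul, neg_one_mul, ← sub_eq_add_neg]
    ring
  set B : ℝ := 2 * ∏ q ∈ S, (1 + τ q) with hB
  have hψc : ∀ n : ℕ, n ≠ 0 → (¬ ∃ q ∈ S, q ∣ n) → ψ n = 2 := by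
    intro n _ h
    simp only [hψdef, filter_dvd_eq_empty h, Finset.prod_empty]
    norm_num
  have hψB : ∀ n, |ψ n| ≤ B := by
    intro n
    have hsub : S.filter (· ∣ n) ⊆ S := Finset.filter_subset _ _
    have hA0 : ∀ q ∈ S.filter (· ∣ n), 0 ≤ τ q := fun q hq => hτ0 q (hsub hq)
    have h1 : ∏ q ∈ S.filter (· ∣ n), (1 + τ q) ≤ ∏ q ∈ S, (1 + τ q) :=
      Finset.prod_le_prod_of_subset_of_one_le hsub (fun q hq => by linarith [hA0 q hq])
        (fun q hq _ => by linarith [hτ0 q hq])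
    have h2 : |∏ q ∈ S.filter (· ∣ n), (1 - τ q)| ≤ ∏ q ∈ S.filter (· ∣ n), (1 + τ q) := by
      rw [Finset.abs_prod]
      exact Finset.prod_le_prod (fun q _ => abs_nonneg _) fun q hq =>
        (abs_sub _ _).trans (by rw [abs_one, abs_of_nonneg (hA0 q hq)])
    have h3 : 0 ≤ ∏ q ∈ S.filter (· ∣ n), (1 + τ q) := Finset.prod_nonneg fun q hq => by linarith [hA0 q hq]
    calc |ψ n| ≤ |∏ q ∈ S.filter (· ∣ n), (1 + τ q)| + |∏ q ∈ S.filter (· ∣ n), (1 - τ q)| := abs_add_le _ _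
      _ ≤ ∏ q ∈ S, (1 + τ q) + ∏ q ∈ S, (1 + τ q) := by
          rw [abs_of_nonneg h3]; exact add_le_add h1 (h2.trans h1)
      _ = B := by rw [hB]; ring
  obtain ⟨hgs, hTeq⟩ := TI_touch_decomposition c hc0 hLoc S hS ψ 2 B hψc hψB C₁ hC₁ (Tp + Tm) hT
  -- pointwise comparison with the pair sums
  set h : ℕ → ℝ := fun n => if (∃ q ∈ S, q ∣ n) then c n / n *
      ((∑ q ∈ S.filter (· ∣ n), τ q) ^ 2 - ∑ q ∈ S.filter (· ∣ n), τ q ^ 2) else 0 with hhdef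
  have hA0 : ∀ n, ∀ q ∈ S.filter (· ∣ n), 0 ≤ τ q := fun n q hq => hτ0 q (Finset.filter_subset _ _ hq)
  have hh0 : ∀ n, 0 ≤ h n := by
    intro n
    simp only [hhdef]
    split_ifs
    · exact mul_nonneg (div_nonneg (hc0 n) (Nat.cast_nonneg _))
        (sub_nonneg.2 (evenPart_bounds τ _ (hA0 n)).2.2)
    · exact le_rfl
  have hhg : ∀ n, h n ≤ (if (∃ q ∈ S, q ∣ n) then
      (c n - ArithmeticFunction.vonMangoldt n) / n * (ψ n - 2) else 0) := by
    intro n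
    by_cases ht : ∃ q ∈ S, q ∣ n
    · simp only [hhdef, if_pos ht]
      have hk : 1 ≤ (S.filter (· ∣ n)).card := by
        obtain ⟨q, hq, hqn⟩ := ht
        exact Finset.card_pos.2 ⟨q, Finset.mem_filter.2 ⟨hq, hqn⟩⟩
      by_cases hk1 : (S.filter (· ∣ n)).card = 1
      · -- class of size one: both sides vanish
        obtain ⟨q, hq⟩ := Finset.card_eq_one.1 hk1
        simp only [hψdef, hq, Finset.sum_singleton, Finset.prod_singleton]
        ring_nf
        exact le_rfl
      · -- class of size ≥ 2: `Λ(n) = 0` and the even-part bound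
        have hΛ : ArithmeticFunction.vonMangoldt n = 0 := vonMangoldt_eq_zero_of_two_le_card hS (by omega)
        rw [hΛ, sub_zero]
        exact mul_le_mul_of_nonneg_left (by linarith [(evenPart_bounds τ _ (hA0 n)).1])
          (div_nonneg (hc0 n) (Nat.cast_nonneg _))
    · simp only [hhdef, if_neg ht]; exact le_rfl
  have hhs : Summable h := Summable.of_nonneg_of_le hh0 hhg hgs
  have hhle : ∑' n : ℕ, h n ≤ 1 - 2 * C₁ := by
    have := hhs.tsum_le_tsum hhg hgs
    linarith
  -- rewrite `h` through the ordered pairs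
  have hhp : ∀ n, h n = 2 * (if (∃ q ∈ S, q ∣ n) then c n / n *
      (∑ q ∈ S.filter (· ∣ n), ∑ q' ∈ (S.filter (· ∣ n)).filter (fun q' => q < q'),
        ((Real.sqrt q - 1) / 2) * ((Real.sqrt q' - 1) / 2)) else 0) := by
    intro n
    simp only [hhdef]
    split_ifs
    · rw [sum_pairs_eq τ]; simp only [hτdef]; ring
    · ring
  have hsum2 : Summable (fun n : ℕ => if (∃ q ∈ S, q ∣ n) then c n / n *
      (∑ q ∈ S.filter (· ∣ n), ∑ q' ∈ (S.filter (· ∣ n)).filter (fun q' => q < q'),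
        ((Real.sqrt q - 1) / 2) * ((Real.sqrt q' - 1) / 2)) else 0) := by
    have := hhs.mul_left (1 / 2)
    refine this.congr fun n => ?_
    rw [hhp n]; ring
  refine ⟨hsum2, ?_⟩
  have h2 : ∑' n : ℕ, h n = 2 * ∑' n : ℕ, (if (∃ q ∈ S, q ∣ n) then c n / n *
      (∑ q ∈ S.filter (· ∣ n), ∑ q' ∈ (S.filter (· ∣ n)).filter (fun q' => q < q'),
        ((Real.sqrt q - 1) / 2) * ((Real.sqrt q' - 1) / 2)) else 0) := by
    rw [← tsum_mul_left]; exact tsum_congr hhp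
  linarith

/-- **AX-B** (seat-0, design algebra §4): under Loc and TI the composite-mass series
`Σ_{n ≥ 2, not a prime power} (c(n)/n) e₂(n)` converges. [folklore] -/
theorem summable_compMassTerm (c : ℕ → ℝ) (hc0 : ∀ n, 0 ≤ c n)
    (hLoc : ∀ p : ℕ, p.Prime → Summable (fun n : ℕ => if p ∣ n then c n / n else 0))
    (hTI : ∀ α : ℕ → ℂ, ∀ L : ℕ, (∀ m, L < m → α m = 0) →
      ∃ T : ℝ, Tendsto (fun x : ℝ => ∑ n ∈ Finset.Icc 1 ⌊x⌋₊,
          (c n - ArithmeticFunction.vonMangoldt n) / n *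
            (∑ ℓ ∈ Finset.Icc 1 L, ∑ ℓ' ∈ Finset.Icc 1 L, α ℓ * (starRingEnd ℂ) (α ℓ') *
            (((Nat.gcd (n * ℓ') ℓ : ℕ) : ℝ) : ℂ) / (Real.sqrt ((ℓ : ℝ) * ℓ') : ℂ)).re) atTop (𝓝 T) ∧
        T ≤ 1 / 2 * (∑ ℓ ∈ Finset.Icc 1 L, ∑ ℓ' ∈ Finset.Icc 1 L, α ℓ * (starRingEnd ℂ) (α ℓ') *
            (((Nat.gcd (1 * ℓ') ℓ : ℕ) : ℝ) : ℂ) / (Real.sqrt ((ℓ : ℝ) * ℓ') : ℂ)).re) :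
    Summable (fun n : ℕ => if 2 ≤ n ∧ ¬ IsPrimePow n then
      c n / (n : ℝ) * (∑ q ∈ n.primeFactors, ∑ q' ∈ n.primeFactors.filter (fun q' => q < q'),
        ((Real.sqrt q - 1) / 2) * ((Real.sqrt q' - 1) / 2)) else 0) := by
  classical
  obtain ⟨C₁, hC₁, -⟩ := exists_C1 c hTI
  have hτ0 : ∀ q : ℕ, q.Prime → 0 ≤ (Real.sqrt q - 1) / 2 := by
    intro q hq
    have hs1 : 1 ≤ Real.sqrt q := by
      rw [show (1 : ℝ) = Real.sqrt 1 from Real.sqrt_one.symm]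
      exact Real.sqrt_le_sqrt (by exact_mod_cast hq.one_lt.le)
    linarith
  have h0 : ∀ n : ℕ, 0 ≤ (if 2 ≤ n ∧ ¬ IsPrimePow n then
      c n / (n : ℝ) * (∑ q ∈ n.primeFactors, ∑ q' ∈ n.primeFactors.filter (fun q' => q < q'),
        ((Real.sqrt q - 1) / 2) * ((Real.sqrt q' - 1) / 2)) else 0) := by
    intro n
    split_ifs
    · refine mul_nonneg (div_nonneg (hc0 n) (Nat.cast_nonneg _)) (Finset.sum_nonneg fun q hq =>
        Finset.sum_nonneg fun q' hq' => mul_nonneg (hτ0 q (Nat.prime_of_mem_primeFactors hq))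
          (hτ0 q' (Nat.prime_of_mem_primeFactors (Finset.mem_filter.1 hq').1)))
    · exact le_rfl
  refine summable_of_sum_range_le h0 (c := 1 / 2 - C₁) fun N => ?_
  set S : Finset ℕ := Nat.primesBelow N with hSdef
  have hS : ∀ q ∈ S, q.Prime := fun q hq => (Nat.mem_primesBelow.1 hq).2
  obtain ⟨hsum, hle⟩ := compMass_level_le c hc0 hLoc hTI C₁ hC₁ S hS
  have hpt : ∀ n ∈ Finset.range N, (if 2 ≤ n ∧ ¬ IsPrimePow n then
      c n / (n : ℝ) * (∑ q ∈ n.primeFactors, ∑ q' ∈ n.primeFactors.filter (fun q' => q < q'),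
        ((Real.sqrt q - 1) / 2) * ((Real.sqrt q' - 1) / 2)) else 0) ≤
      (if (∃ q ∈ S, q ∣ n) then c n / n *
        (∑ q ∈ S.filter (· ∣ n), ∑ q' ∈ (S.filter (· ∣ n)).filter (fun q' => q < q'),
          ((Real.sqrt q - 1) / 2) * ((Real.sqrt q' - 1) / 2)) else 0) := by
    intro n hn
    have hnN : n < N := Finset.mem_range.1 hn
    by_cases hc : 2 ≤ n ∧ ¬ IsPrimePow n
    · have hA : S.filter (· ∣ n) = n.primeFactors := by
        ext q
        simp only [Finset.mem_filter, hSdef, Nat.mem_primesBelow, Nat.mem_primeFactors]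
        constructor
        · rintro ⟨⟨_, hq⟩, hqn⟩
          exact ⟨hq, hqn, by omega⟩
        · rintro ⟨hq, hqn, _⟩
          exact ⟨⟨lt_of_le_of_lt (Nat.le_of_dvd (by omega) hqn) hnN, hq⟩, hqn⟩
      have ht : ∃ q ∈ S, q ∣ n := by
        obtain ⟨q, hq, hqn⟩ := Nat.exists_prime_and_dvd (by omega : n ≠ 1)
        exact ⟨q, Nat.mem_primesBelow.2 ⟨lt_of_le_of_lt (Nat.le_of_dvd (by omega) hqn) hnN, hq⟩, hqn⟩
      rw [if_pos hc, if_pos ht, hA]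
    · rw [if_neg hc]
      split_ifs with ht
      · exact mul_nonneg (div_nonneg (hc0 n) (Nat.cast_nonneg _)) (Finset.sum_nonneg fun q hq =>
          Finset.sum_nonneg fun q' hq' => mul_nonneg (hτ0 q (hS q (Finset.mem_filter.1 hq).1))
            (hτ0 q' (hS q' (Finset.mem_filter.1 (Finset.mem_filter.1 hq').1).1)))
      · exact le_rfl
  have hnn : ∀ n, 0 ≤ (if (∃ q ∈ S, q ∣ n) then c n / n *
      (∑ q ∈ S.filter (· ∣ n), ∑ q' ∈ (S.filter (· ∣ n)).filter (fun q' => q < q'),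
        ((Real.sqrt q - 1) / 2) * ((Real.sqrt q' - 1) / 2)) else 0) := by
    intro n
    split_ifs
    · exact mul_nonneg (div_nonneg (hc0 n) (Nat.cast_nonneg _)) (Finset.sum_nonneg fun q hq =>
        Finset.sum_nonneg fun q' hq' => mul_nonneg (hτ0 q (hS q (Finset.mem_filter.1 hq).1))
          (hτ0 q' (hS q' (Finset.mem_filter.1 (Finset.mem_filter.1 hq').1).1)))
    · exact le_rfl
  calc ∑ n ∈ Finset.range N, (if 2 ≤ n ∧ ¬ IsPrimePow n then
        c n / (n : ℝ) * (∑ q ∈ n.primeFactors, ∑ q' ∈ n.primeFactors.filter (fun q' => q < q'),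
          ((Real.sqrt q - 1) / 2) * ((Real.sqrt q' - 1) / 2)) else 0)
      ≤ ∑ n ∈ Finset.range N, (if (∃ q ∈ S, q ∣ n) then c n / n *
        (∑ q ∈ S.filter (· ∣ n), ∑ q' ∈ (S.filter (· ∣ n)).filter (fun q' => q < q'),
          ((Real.sqrt q - 1) / 2) * ((Real.sqrt q' - 1) / 2)) else 0) := Finset.sum_le_sum hpt
    _ ≤ ∑' n : ℕ, (if (∃ q ∈ S, q ∣ n) then c n / n *
        (∑ q ∈ S.filter (· ∣ n), ∑ q' ∈ (S.filter (· ∣ n)).filter (fun q' => q < q'),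
          ((Real.sqrt q - 1) / 2) * ((Real.sqrt q' - 1) / 2)) else 0) :=
        hsum.sum_le_tsum _ (fun n _ => hnn n)
    _ ≤ 1 / 2 - C₁ := hle

/-- **Registered sub-goal `designAxB`** (seat-0 anchor of this file, design algebra §4 of the proof of
`stub_designOfTypes`): under Loc and TI the composite-mass series AX-B converges. [folklore] -/
theorem designAxB : ∀ c : ℕ → ℝ, (∀ n, 0 ≤ c n) →
    (∀ p : ℕ, p.Prime → Summable (fun n : ℕ => if p ∣ n then c n / n else 0)) →
    (∀ α : ℕ → ℂ, ∀ L : ℕ, (∀ m, L < m → α m = 0) →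
      ∃ T : ℝ, Filter.Tendsto (fun x : ℝ => ∑ n ∈ Finset.Icc 1 ⌊x⌋₊,
          (c n - ArithmeticFunction.vonMangoldt n) / n *
            (∑ ℓ ∈ Finset.Icc 1 L, ∑ ℓ' ∈ Finset.Icc 1 L, α ℓ * (starRingEnd ℂ) (α ℓ') *
            (((Nat.gcd (n * ℓ') ℓ : ℕ) : ℝ) : ℂ) / (Real.sqrt ((ℓ : ℝ) * ℓ') : ℂ)).re) Filter.atTop (nhds T) ∧
        T ≤ 1 / 2 * (∑ ℓ ∈ Finset.Icc 1 L, ∑ ℓ' ∈ Finset.Icc 1 L, α ℓ * (starRingEnd ℂ) (α ℓ') *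
            (((Nat.gcd (1 * ℓ') ℓ : ℕ) : ℝ) : ℂ) / (Real.sqrt ((ℓ : ℝ) * ℓ') : ℂ)).re) →
    Summable (fun n : ℕ => if 2 ≤ n ∧ ¬ IsPrimePow n then
      c n / (n : ℝ) * (∑ q ∈ n.primeFactors, ∑ q' ∈ n.primeFactors.filter (fun q' => q < q'),
        ((Real.sqrt q - 1) / 2) * ((Real.sqrt q' - 1) / 2)) else 0) :=
  fun c hc0 hLoc hTI => summable_compMassTerm c hc0 hLoc hTI

end Design

end Summit.RiemannHypothesis.RiemannHypothesis.Theorems.SignConeConeMagnification
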